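import Literature.AlgebraicGeometry.AbelianSchemes.AbelianSchemeOverMulNEtale
import HarnessLib

/-!
# `[N]_X : X → X` is SURJECTIVE for `N` invertible on the base (an fppf / finite étale cover)

For an abelian scheme `X/S` and `N` with `(N : κ(s)) ≠ 0` for every `s ∈ S`, multiplication by `N` is surjective
(`surjective_pow_id_left`): a point `y` of `X` lies on the fibre `X_s` (`s = π y`), where `[N]_{X_s}` is `[N]` of the
abelian VARIETY `X_s`, an isogeny ([MumfordAV1970] §6 Application 2 p. 62, [GortzWedhorn2023] Prop. 27.186: finite
and surjective — ★ `AbelianVariety.isIsogeny_zsmul_id_of_cast_ne_zero`), and the fibre square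
`([N]_{X_s}, X_s → X; X_s → X, [N]_X)` commutes.  With ★ `flat_pow_id_left`, `etale_pow_id_left`, `isFinite_pow_id_left`
(`AbelianSchemes/AbelianSchemeOverMulNEtale`) this makes `[N]_X` a finite étale (fppf) COVER of `X` — the form in which
«étale-locally every `T`-point of `X` is divisible by `N`» is used.

* `surjective_pow_id_left` — `[N]_X` is surjective for `N` invertible on `S`;
* `surjective_pow_id_left_of_charZero` — the same over a base of characteristic `0`;
* `fppfCover_pow_id_left` — `[N]_X` is a flat, surjective, finite (hence quasi-compact)
  étale morphism: the `Surjective ⊓ Flat ⊓ QuasiCompact` package Mathlib descent statements consume.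

## References

* [MumfordAV1970] D. Mumford, *Abelian Varieties* (1970), §6 Application 2 (p. 62); §19 Remark (p. 172).
* [GortzWedhorn2023] U. Görtz, T. Wedhorn, *Algebraic Geometry II* (2023), Prop. 27.186 (p. 674).
-/

noncomputable section

universe u

open CategoryTheory CategoryTheory.Limits AlgebraicGeometry MonoidalCategory CartesianMonoidalCategory

open scoped MonObj

namespace Literature.AlgebraicGeometry.AbelianSchemes

namespace AbelianSchemeOver

open Literature.AlgebraicGeometry.Motives

variable {S : Scheme.{u}} (A : AbelianSchemeOver S)

/-- Over a field `K` of characteristic zero a nonzero natural number `N` is nonzero in every residue field `κ(s)` of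
`S`. [folklore] -/
private theorem natCast_residueField_ne_zero_of_charZero'' {K : Type u} [Field K] [CharZero K]
    (f : S ⟶ Spec (.of K)) (s : S) {N : ℕ} (hN : N ≠ 0) : (N : S.residueField s) ≠ 0 := by
  let φ : K →+* S.residueField s := (Spec.preimage (S.fromSpecResidueField s ≫ f)).hom
  rw [← map_natCast φ N]
  exact (map_ne_zero φ).mpr (Nat.cast_ne_zero.mpr hN)

/-- **`[N]_X` is surjective for `N` invertible on the base**: every point `y ∈ X` lies on its fibre `X_s`, on which `[N]`
is an isogeny of the abelian variety `X_s`, hence surjective; a preimage on the fibre maps to a preimage in `X`.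
[cite: MumfordAV1970, §6 Application 2 (p. 62)] [cite: GortzWedhorn2023, Prop. 27.186 (p. 674)] -/
theorem surjective_pow_id_left {N : ℕ} (hN : ∀ s : S, (N : S.residueField s) ≠ 0) :
    Surjective ((((𝟙 A.X : A.X ⟶ A.X) ^ N) : A.X ⟶ A.X).left) := by
  refine ⟨fun y => ?_⟩
  -- `y` lies on the fibre `X_s`, `s = π y`
  obtain ⟨y', hy'⟩ := exists_fst_fromSpecResidueField_eq A.X y
  -- `[N]_{X_s}` is `[N]` of the abelian variety `X_s`, an isogeny, hence surjective
  have hN' : ((N : ℤ) : S.residueField (A.X.hom.base y)) ≠ 0 := by rw [Int.cast_natCast]; exact hN _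
  have e1 : AbelianVariety.Hom.toSchemeHom
        ((N : ℤ) • 𝟙 (A.fibre (S.fromSpecResidueField (A.X.hom.base y))).toAbelianVariety) =
      ((Over.pullback (S.fromSpecResidueField (A.X.hom.base y))).map ((𝟙 A.X : A.X ⟶ A.X) ^ N)).left := by
    change (((N : ℤ) • 𝟙 (A.fibre (S.fromSpecResidueField (A.X.hom.base y))).toAbelianVariety).hom.hom.hom).left = _
    rw [AbelianVariety.hom_zsmul_id, zpow_natCast, map_id_pow']
    rfl
  have hiso := AbelianVariety.isIsogeny_zsmul_id_of_cast_ne_zero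
    (A := (A.fibre (S.fromSpecResidueField (A.X.hom.base y))).toAbelianVariety) (N : ℤ) hN'
  have hsurj : Function.Surjective
      ((Over.pullback (S.fromSpecResidueField (A.X.hom.base y))).map ((𝟙 A.X : A.X ⟶ A.X) ^ N)).left := by
    rw [← e1]
    exact hiso.1.surj
  obtain ⟨z', hz'⟩ := hsurj y'
  -- the fibre square commutes: `[N]_{X_s} ≫ (X_s → X) = (X_s → X) ≫ [N]_X`
  refine ⟨pullback.fst A.X.hom (S.fromSpecResidueField (A.X.hom.base y)) z', ?_⟩
  have hsq := (Literature.AlgebraicGeometry.Limits.isPullback_pullback_map_left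
    (S.fromSpecResidueField (A.X.hom.base y)) ((𝟙 A.X : A.X ⟶ A.X) ^ N)).w
  have := congrArg (fun f => f z') hsq
  simp only [Scheme.Hom.comp_apply] at this
  exact this.symm.trans
    ((congrArg (fun t => pullback.fst A.X.hom (S.fromSpecResidueField (A.X.hom.base y)) t) hz').trans hy')

/-- **`[N]_X` is surjective over a base of characteristic zero** (`S` over a field `K` with `CharZero K`, `N ≠ 0`).
[cite: MumfordAV1970, §6 Application 2 (p. 62)] -/
theorem surjective_pow_id_left_of_charZero {K : Type u} [Field K] [CharZero K] (f : S ⟶ Spec (.of K)) {N : ℕ}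
    (hN : N ≠ 0) : Surjective ((((𝟙 A.X : A.X ⟶ A.X) ^ N) : A.X ⟶ A.X).left) :=
  A.surjective_pow_id_left fun s => natCast_residueField_ne_zero_of_charZero'' f s hN

/-- **`[N]_X` is an fppf (indeed finite étale) cover of `X`** for `N` invertible on the base: surjective, flat and
quasi-compact — the shape Mathlib's descent statements (`MorphismProperty.DescendsAlong … (@Surjective ⊓ @Flat ⊓
@QuasiCompact)`) consume. [cite: GortzWedhorn2023, Prop. 27.186 (p. 674)] -/
theorem fppfCover_pow_id_left {N : ℕ} (hN : ∀ s : S, (N : S.residueField s) ≠ 0) :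
    (@Surjective ⊓ @Flat ⊓ @QuasiCompact : MorphismProperty Scheme.{u})
      ((((𝟙 A.X : A.X ⟶ A.X) ^ N) : A.X ⟶ A.X).left) := by
  haveI := A.surjective_pow_id_left hN
  haveI := A.flat_pow_id_left hN
  haveI := A.isFinite_pow_id_left hN
  exact ⟨⟨inferInstance, inferInstance⟩, inferInstance⟩

end AbelianSchemeOver

end Literature.AlgebraicGeometry.AbelianSchemes

end
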